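import Mathlib
import HarnessLib
import Summits.NavierStokesRegularity.NavierStokesRegularity.Theorems.PoloidalWindowDoorLrcModEntireParallelWebs

/-!
# Route `PoloidalWindowDoor`, item `LrcModEntire` (stmt-NavierStokesRegularity-20428), cell (Q4-sonic, straight, μ < 0) `stub_Q4sonicLineNeg`, case I —
# BRICK B-T (rigidity half): an `s`-MODULATED NULL WEB SHEET OBEYING THE GRAPH TRANSPORT LAW IS `s`-FREE

Cell ns-regularity-ideate, stub-worker seat ns-poloidal-K2-p2 g16 under the LEAD of item 20428 (ns-poloidal-K2-p3 g17);
`--supports stmt-NavierStokesRegularity-20428 --as helper`.  Memo `Cruxes/LrcModEntire/T2B-g17.md` v2 §1 (case I) / §5(5g) BRICK B-T («(Q4 binders) ∧ Γ line ∧ R(τ,·)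
affine at a time τ ⇒ the maximiser n₀(τ,s,z) is s-free, d_z² = −μ»), done in GRAPH COORDINATES over the line (no Fermi re-instantiation of the web package):
the web sheet at a sonic time is `W(s,z) = s·e + G(s,z)·Je + z·e₂` with `G` a priori `s`-DEPENDENT, `|G| ≤ r`.  Two identities hold on it (the PDE half,
file `…GraphTransport`, derives them from the slice law, web criticality, the constant vertical gradient and the ridge law):
  (E) EIKONAL      `G_z² = −μ(z)·(1 + G_s²)`                                  (the sheet is null for `∂_z² + μΔₕ`),
  (T) TRANSPORT    `a(z)·G_ss = −(1 + G_s²)·G_z·b(z)`  with `a ≠ 0`            (the graph transport law `∂_z(G_zA²) + μ∂_s(G_sA²) = 0` combined with (E)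
                                                                              and the ridge law `A(1+G_s²) = −K(z)`; `a = μ²K²`, `b = ½μ′K² + 2μKK′`).
★ `sfree_of_eikonal_transport` — (E) + (T) + `μ < 0` + `|G| ≤ r` on the region `ℝ × I` ⇒ `∂_sG ≡ 0` there.  PROOF (pure calculus, one height at a time):
`u := G_s/G_z` has `∂_su = −b/a` CONSTANT in `s` ((E), its `s`-derivative, (T)); `u² < 1/(−μ)` is bounded ⇒ `b = 0` ⇒ `G_ss ≡ 0` ⇒ `G(·,z)` affine and bounded
⇒ `G_s ≡ 0`.  The 1-D core is `deriv_ratio_const` / `eq_zero_of_affine_bounded`.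
* `sfree_eikonal` — consequently `G(s,z) = G(0,z)` and `d := G(0,·)` satisfies `d′(z)² = −μ(z)` (B-T (ii)).

Class-free calculus.  WHAT THIS IS NOT: not a claim about Navier–Stokes regularity — a lemma for research cell (Q4-sonic) of line twist_split; items 20428 / 19708 /
27893 OPEN.
-/

noncomputable section

-- the summit and its single sub-problem share the name (CONVENTIONS §1), as in every Theorems file
set_option linter.dupNamespace false

namespace Summit.NavierStokesRegularity.NavierStokesRegularity.Theorems.PoloidalWindowDoorLrcModEntireGraphTransportRigidity

open Set Function Filter Topology
open Summit.NavierStokesRegularity.NavierStokesRegularity.Theorems.PoloidalWindowDoorLrcModEntireParallelWebsIdentity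
open Summit.NavierStokesRegularity.NavierStokesRegularity.Theorems.PoloidalWindowDoorLrcModEntireParallelWebs

/-! ### Algebra of the graph transport law (machine-derived polynomial identities; used by `…GraphTransport`) -/

/-- Step 1: the graph transport law `★` from `∂_{Je}` of the slice law (`hP1`), the tangential derivatives of the Hessian entries (`hb1`, `hb2`, `ha1`, `ha2`)
and the eikonal relation (`hE`) — the transversal third derivative `t1 = D³θ[Je,Je,Je]` cancels. -/
theorem star_algebra {Ps Pz Pss Pzz A As Az μz t1 t2 t3 t4 t5 : ℝ}
    (hP1 : t5 + μz * t4 + μz * t1 = 0)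
    (hb1 : t4 + Ps * t2 + Pss * A + Ps * As = 0)
    (hb2 : Pz * t3 + t5 + Pzz * A + Pz * Az = 0)
    (ha1 : As = t2 + Ps * t1) (ha2 : Az = Pz * t1 + t3)
    (hE : Pz ^ 2 + μz * (1 + Ps ^ 2) = 0) :
    Pzz * A + 2 * Pz * Az + μz * Pss * A + 2 * μz * Ps * As = 0 := by
  linear_combination (hb2 - hP1) + μz * hb1 + Pz * ha2 + μz * Ps * ha1 + t1 * hE

/-- Step 2: `★` + the differentiated ridge law (`hr1`, `hr2`) and eikonal relation (`he1`, `he2`), symmetry of `D²G`, (E) and the ridge law ⇒ (T). -/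
theorem transport_algebra {Ps Pz Pss Psz Pzs Pzz A As Az K K' μ μ' : ℝ} (hq : (1 + Ps ^ 2) ≠ 0)
    (hstar : Pzz * A + 2 * Pz * Az + μ * Pss * A + 2 * μ * Ps * As = 0)
    (hr1 : As * (1 + Ps ^ 2) + 2 * A * Ps * Pss = 0)
    (hr2 : Az * (1 + Ps ^ 2) + 2 * A * Ps * Psz + K' = 0)
    (he1 : 2 * Pz * Pzs + 2 * μ * Ps * Pss = 0)
    (he2 : 2 * Pz * Pzz + μ' * (1 + Ps ^ 2) + 2 * μ * Ps * Psz = 0)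
    (hsym : Psz - Pzs = 0) (hE : Pz ^ 2 + μ * (1 + Ps ^ 2) = 0) (hRd : A * (1 + Ps ^ 2) + K = 0) :
    μ ^ 2 * K ^ 2 * Pss = -(1 + Ps ^ 2) * Pz * (1 / 2 * μ' * K ^ 2 + 2 * μ * K * K') := by
  have h2 : 2 * (1 + Ps ^ 2) * (μ ^ 2 * K ^ 2 * Pss + (1 + Ps ^ 2) * Pz * (1 / 2 * μ' * K ^ 2 + 2 * μ * K * K')) = 0 := by
    linear_combination (K * 2 * Pz ^ 2 * (1 + Ps ^ 2) ^ 2) * hstar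
      - ((1 : ℝ) * Pz * A * K + (2 : ℝ) * Ps ^ 2 * Pz * A * K + (1 : ℝ) * Ps ^ 4 * Pz * A * K) * he2
      - ((4 : ℝ) * Pz ^ 3 * K + (4 : ℝ) * Ps ^ 2 * Pz ^ 3 * K) * hr2
      - ((4 : ℝ) * Ps * Pz ^ 2 * K * μ + (4 : ℝ) * Ps ^ 3 * Pz ^ 2 * K * μ) * hr1
      - ((-2 : ℝ) * Ps * Pz * A * K * μ + (-8 : ℝ) * Ps * Pz ^ 3 * A * K + (-4 : ℝ) * Ps ^ 3 * Pz * A * K * μ +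
          (-8 : ℝ) * Ps ^ 3 * Pz ^ 3 * A * K + (-2 : ℝ) * Ps ^ 5 * Pz * A * K * μ) * hsym
      - ((-1 : ℝ) * Ps * A * K * μ + (-4 : ℝ) * Ps * Pz ^ 2 * A * K + (-2 : ℝ) * Ps ^ 3 * A * K * μ + (-4 : ℝ) * Ps ^ 3 * Pz ^ 2 * A * K +
          (-1 : ℝ) * Ps ^ 5 * A * K * μ) * he1
      - ((2 : ℝ) * Pss * A * K * μ + (-4 : ℝ) * Pz * K * K' + (4 : ℝ) * Ps ^ 2 * Pss * A * K * μ + (-4 : ℝ) * Ps ^ 2 * Pz * K * K' +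
          (2 : ℝ) * Ps ^ 4 * Pss * A * K * μ) * hE
      - ((-2 : ℝ) * Pss * K * μ ^ 2 + (-1 : ℝ) * Pz * K * μ' + (-2 : ℝ) * Ps ^ 2 * Pss * K * μ ^ 2 + (-2 : ℝ) * Ps ^ 2 * Pz * K * μ' +
          (-1 : ℝ) * Ps ^ 4 * Pz * K * μ') * hRd
  have h3 : μ ^ 2 * K ^ 2 * Pss + (1 + Ps ^ 2) * Pz * (1 / 2 * μ' * K ^ 2 + 2 * μ * K * K') = 0 := by
    rcases mul_eq_zero.1 h2 with h | h
    · exact absurd (by linarith : (1 + Ps ^ 2) = 0) hq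
    · exact h
  linear_combination h3

/-! ### 1-D core -/

/-- A function with an everywhere-defined derivative which is bounded in absolute value is not affine with non-zero slope:
if `g′ ≡ c` and `|g| ≤ r` then `c = 0`. -/
theorem eq_zero_of_affine_bounded {g : ℝ → ℝ} {c r : ℝ} (hg : ∀ s, HasDerivAt g c s) (hb : ∀ s, |g s| ≤ r) : c = 0 := by
  by_contra hc
  have hr : 0 ≤ r := (abs_nonneg _).trans (hb 0)
  -- `g s - c s` is constant
  have hv : ∀ s, HasDerivAt (fun s => g s - c * s) 0 s := fun s => by
    have h := (hg s).fun_sub ((hasDerivAt_id' s).const_mul c)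
    simpa using h
  have hconst := is_const_of_deriv_eq_zero (fun s => (hv s).differentiableAt) (fun s => (hv s).deriv)
  set s₁ : ℝ := (2 * r + 1) / c with hs₁
  have h1 : g s₁ - c * s₁ = g 0 - c * 0 := hconst s₁ 0
  have h2 : c * s₁ = 2 * r + 1 := by rw [hs₁]; field_simp
  have h3 : |g s₁| ≤ r := hb s₁
  have h4 : |g 0| ≤ r := hb 0
  rw [abs_le] at h3 h4
  nlinarith [h3.1, h3.2, h4.1, h4.2]

/-- **The ratio `u = P/Z` has constant derivative.**  If `Z² = −m(1+P²)` (so `Z ≠ 0` when `m < 0`), `Z Z′ = −m P P′` (its derivative) and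
`A·P′ = −(1+P²)·Z·B` with `A ≠ 0`, then `(P/Z)′ = −B/A`. -/
theorem hasDerivAt_ratio {P Z : ℝ → ℝ} {P' Z' m A B : ℝ} {s : ℝ} (hP : HasDerivAt P P' s) (hZ : HasDerivAt Z Z' s)
    (hZ0 : Z s ≠ 0) (hA : A ≠ 0)
    (hE : Z s ^ 2 = -m * (1 + P s ^ 2)) (hEd : Z s * Z' = -m * (P s * P')) (hT : A * P' = -(1 + P s ^ 2) * Z s * B) :
    HasDerivAt (fun x => P x / Z x) (-B / A) s := by
  have h := hP.div hZ hZ0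
  have hnum : (P' * Z s - P s * Z') * A * Z s = -B * Z s ^ 3 := by
    linear_combination (Z s ^ 2 + m * P s ^ 2) * hT + (-(P s * A)) * hEd + (-(P s ^ 2 * Z s * B)) * hE
  have hval : (P' * Z s - P s * Z') / Z s ^ 2 = -B / A := by
    rw [div_eq_div_iff (pow_ne_zero 2 hZ0) hA]
    apply mul_right_cancel₀ hZ0
    linear_combination hnum
  exact hval ▸ h

/-- ★ **1-D RIGIDITY.**  `g` with `g′ = P`, `P′`, `Z`, `Z′` everywhere; `|g| ≤ r`; the eikonal relation `Z² = −m(1+P²)` (`m < 0`) and the transport relation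
`A·P′ = −(1+P²)·Z·B` (`A ≠ 0`) for all `s` ⇒ `P ≡ 0`. -/
theorem eq_zero_of_eikonal_transport_1d {g P Z P' Z' : ℝ → ℝ} {m A B r : ℝ} (hm : m < 0) (hA : A ≠ 0)
    (hg : ∀ s, HasDerivAt g (P s) s) (hP : ∀ s, HasDerivAt P (P' s) s) (hZ : ∀ s, HasDerivAt Z (Z' s) s)
    (hb : ∀ s, |g s| ≤ r)
    (hE : ∀ s, Z s ^ 2 = -m * (1 + P s ^ 2)) (hT : ∀ s, A * P' s = -(1 + P s ^ 2) * Z s * B) : ∀ s, P s = 0 := by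
  have hZ0 : ∀ s, Z s ≠ 0 := fun s h => by
    have := hE s; rw [h] at this; nlinarith [sq_nonneg (P s)]
  -- the `s`-derivative of the eikonal relation
  have hEd : ∀ s, Z s * Z' s = -m * (P s * P' s) := by
    intro s
    have h1 : HasDerivAt (fun x => Z x * Z x) (Z' s * Z s + Z s * Z' s) s := (hZ s).fun_mul (hZ s)
    have h2 : HasDerivAt (fun x => -m * (1 + P x * P x)) (-m * (P' s * P s + P s * P' s)) s :=
      (((hP s).fun_mul (hP s)).const_add 1).const_mul (-m)
    have hfun : (fun x => Z x * Z x) = fun x => -m * (1 + P x * P x) := by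
      funext x; rw [← sq, ← sq]; exact hE x
    rw [hfun] at h1
    have := h1.unique h2
    linarith
  -- `u = P/Z` is affine with slope `−B/A` and bounded ⇒ `B = 0`
  have hu : ∀ s, HasDerivAt (fun x => P x / Z x) (-B / A) s := fun s =>
    hasDerivAt_ratio (hP s) (hZ s) (hZ0 s) hA (hE s) (hEd s) (hT s)
  have hub : ∀ s, |P s / Z s| ≤ 1 - 1 / m := by
    intro s
    have hm0 : m ≠ 0 := ne_of_lt hm
    have hm' : 0 < -1 / m := by
      rw [div_eq_mul_inv]; nlinarith [inv_lt_zero.2 hm]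
    have hZ2 : 0 < Z s ^ 2 := lt_of_le_of_ne (sq_nonneg _) (Ne.symm (pow_ne_zero 2 (hZ0 s)))
    have hsq : (P s / Z s) ^ 2 < -1 / m := by
      rw [div_pow, div_lt_iff₀ hZ2, hE s]
      have : -1 / m * (-m * (1 + P s ^ 2)) = 1 + P s ^ 2 := by field_simp
      rw [this]; linarith
    have ht : (1 : ℝ) - 1 / m = 1 + -1 / m := by ring
    have hN : (1 - 1 / m) ^ 2 ≥ -1 / m := by rw [ht]; nlinarith [hm']
    by_contra hlt
    push Not at hlt
    have h1 : 1 - 1 / m < |P s / Z s| := hlt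
    have h2 : (1 - 1 / m) ^ 2 < (P s / Z s) ^ 2 := by
      rw [← sq_abs (P s / Z s)]
      exact pow_lt_pow_left₀ h1 (by rw [ht]; linarith) two_ne_zero
    linarith
  have hBA : -B / A = 0 := eq_zero_of_affine_bounded hu hub
  have hB : B = 0 := by
    rw [div_eq_zero_iff] at hBA
    rcases hBA with h | h
    · linarith
    · exact absurd h hA
  -- `P′ ≡ 0` ⇒ `P` constant ⇒ `g` affine and bounded ⇒ `P ≡ 0`
  have hP'0 : ∀ s, P' s = 0 := fun s => by
    have h := hT s
    rw [hB, mul_zero] at h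
    rcases mul_eq_zero.1 h with h' | h'
    · exact absurd h' hA
    · exact h'
  have hPc : ∀ s, P s = P 0 := fun s =>
    is_const_of_deriv_eq_zero (fun x => (hP x).differentiableAt) (fun x => by rw [(hP x).deriv, hP'0]) s 0
  have hg' : ∀ s, HasDerivAt g (P 0) s := fun s => hPc s ▸ hg s
  have hc : P 0 = 0 := eq_zero_of_affine_bounded hg' hb
  intro s; rw [hPc, hc]

/-! ### Region form -/

/-- ★ **B-T, rigidity half: an `s`-modulated null web sheet obeying the graph transport law is `s`-free.**  `G` is `C²` on the open region `ℝ × I`, bounded by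
`r`; (E) and (T) hold there with `μ < 0`, `a ≠ 0` on `I` ⇒ `∂_sG = 0` on the region. -/
theorem sfree_of_eikonal_transport {G : ℝ × ℝ → ℝ} {I : Set ℝ} (hI : IsOpen I) (hG : ContDiffOn ℝ 2 G (region I))
    {r : ℝ} (hGb : ∀ p ∈ region I, |G p| ≤ r)
    {μ a b : ℝ → ℝ} (hμ : ∀ z ∈ I, μ z < 0) (ha : ∀ z ∈ I, a z ≠ 0)
    (hE : ∀ p ∈ region I, (fderiv ℝ G p (0, 1)) ^ 2 = -μ p.2 * (1 + (fderiv ℝ G p (1, 0)) ^ 2))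
    (hT : ∀ p ∈ region I, a p.2 * fderiv ℝ (fun q => fderiv ℝ G q (1, 0)) p (1, 0) =
        -(1 + (fderiv ℝ G p (1, 0)) ^ 2) * fderiv ℝ G p (0, 1) * b p.2) :
    ∀ p ∈ region I, fderiv ℝ G p (1, 0) = 0 := by
  intro p hp
  set z : ℝ := p.2 with hz
  have hzI : z ∈ I := hp
  have hmem : ∀ s : ℝ, ((s, z) : ℝ × ℝ) ∈ region I := fun _ => hzI
  have hGat : ∀ s : ℝ, ContDiffAt ℝ 2 G (s, z) := fun s => hG.contDiffAt ((isOpen_region hI).mem_nhds (hmem s))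
  have hGd : ∀ s : ℝ, DifferentiableAt ℝ G (s, z) := fun s => (hGat s).differentiableAt (by norm_num)
  have hG1 : ∀ s : ℝ, DifferentiableAt ℝ (fderiv ℝ G) (s, z) := fun s =>
    ((hGat s).fderiv_right (m := 1) (by norm_num)).differentiableAt (by norm_num)
  have hline : ∀ s : ℝ, HasDerivAt (fun s : ℝ => ((s, z) : ℝ × ℝ)) ((1 : ℝ), (0 : ℝ)) s := fun s =>
    (hasDerivAt_id s).prodMk (hasDerivAt_const s z)
  -- the 1-D data along the height `z`
  have hg : ∀ s, HasDerivAt (fun s => G (s, z)) (fderiv ℝ G (s, z) (1, 0)) s := fun s =>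
    (hGd s).hasFDerivAt.comp_hasDerivAt s (hline s)
  have hP : ∀ s, HasDerivAt (fun s => fderiv ℝ G (s, z) (1, 0)) (fderiv ℝ (fun q => fderiv ℝ G q (1, 0)) (s, z) (1, 0)) s := by
    intro s
    have h1 : DifferentiableAt ℝ (fun q => fderiv ℝ G q (1, 0)) (s, z) := (hG1 s).clm_apply (differentiableAt_const _)
    exact h1.hasFDerivAt.comp_hasDerivAt s (hline s)
  have hZ : ∀ s, HasDerivAt (fun s => fderiv ℝ G (s, z) (0, 1)) (fderiv ℝ (fun q => fderiv ℝ G q (0, 1)) (s, z) (1, 0)) s := by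
    intro s
    have h1 : DifferentiableAt ℝ (fun q => fderiv ℝ G q (0, 1)) (s, z) := (hG1 s).clm_apply (differentiableAt_const _)
    exact h1.hasFDerivAt.comp_hasDerivAt s (hline s)
  have key := eq_zero_of_eikonal_transport_1d (m := μ z) (A := a z) (B := b z) (r := r) (hμ z hzI) (ha z hzI) hg hP hZ
    (fun s => hGb _ (hmem s)) (fun s => hE (s, z) (hmem s)) (fun s => hT (s, z) (hmem s)) p.1
  have hpz : ((p.1, z) : ℝ × ℝ) = p := by rw [hz]
  rw [hpz] at key
  exact key

/-- **B-T (i)+(ii) in graph coordinates:** under the hypotheses of `sfree_of_eikonal_transport`, `G(s,z) = G(0,z)` on the region and the offset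
`d := G(0,·)` obeys `d′(z)² = −μ(z)`. -/
theorem sfree_eikonal {G : ℝ × ℝ → ℝ} {I : Set ℝ} (hI : IsOpen I) (hG : ContDiffOn ℝ 2 G (region I))
    {r : ℝ} (hGb : ∀ p ∈ region I, |G p| ≤ r)
    {μ a b : ℝ → ℝ} (hμ : ∀ z ∈ I, μ z < 0) (ha : ∀ z ∈ I, a z ≠ 0)
    (hE : ∀ p ∈ region I, (fderiv ℝ G p (0, 1)) ^ 2 = -μ p.2 * (1 + (fderiv ℝ G p (1, 0)) ^ 2))
    (hT : ∀ p ∈ region I, a p.2 * fderiv ℝ (fun q => fderiv ℝ G q (1, 0)) p (1, 0) =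
        -(1 + (fderiv ℝ G p (1, 0)) ^ 2) * fderiv ℝ G p (0, 1) * b p.2) :
    (∀ p ∈ region I, G p = G (0, p.2)) ∧ ∀ z ∈ I, deriv (fun z => G (0, z)) z ^ 2 = -μ z := by
  have hs := sfree_of_eikonal_transport hI hG hGb hμ ha hE hT
  refine ⟨fun p hp => ?_, fun z hz => ?_⟩
  · have hGd : ∀ s : ℝ, DifferentiableAt ℝ G (s, p.2) := fun s =>
      (hG.contDiffAt ((isOpen_region hI).mem_nhds (show ((s, p.2) : ℝ × ℝ) ∈ region I from hp))).differentiableAt (by norm_num)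
    have hg : ∀ s, HasDerivAt (fun s => G (s, p.2)) 0 s := fun s => by
      have h := (hGd s).hasFDerivAt.comp_hasDerivAt s ((hasDerivAt_id s).prodMk (hasDerivAt_const s p.2))
      have h0 := hs (s, p.2) hp
      simp only [Function.comp_def, id] at h
      rwa [h0] at h
    have hc := is_const_of_deriv_eq_zero (fun s => (hg s).differentiableAt) (fun s => (hg s).deriv) p.1 0
    simpa using hc
  · have hp : ((0 : ℝ), z) ∈ region I := hz
    have hGd : DifferentiableAt ℝ G (0, z) := (hG.contDiffAt ((isOpen_region hI).mem_nhds hp)).differentiableAt (by norm_num)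
    have h := hE (0, z) hp
    rw [hs (0, z) hp] at h
    rw [← fderiv_apply_zero_one_eq_deriv hGd]
    simpa using h

end Summit.NavierStokesRegularity.NavierStokesRegularity.Theorems.PoloidalWindowDoorLrcModEntireGraphTransportRigidity

end
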